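import Summits.AnomalousDissipation.AnomalousDissipation.Theses.ImpulseGrid
import Summits.AnomalousDissipation.AnomalousDissipation.Theses.Correlation
import Summits.AnomalousDissipation.AnomalousDissipation.Theorems.ImpulseGridBoundedEnergyNoLeakGridStubAbsorbingBallGrid
import HarnessLib

/-!
# `ImpulseGrid.BoundedEnergyNoLeakGrid` is its turbulent-saturation half, modulo Correlation's
# universal no-leakage crux (crux stmt-AnomalousDissipation-14350, line `Sketch`, skeleton v5)

Support file for the crux `Summit.AnomalousDissipation.AnomalousDissipation.Theses.ImpulseGrid.BoundedEnergyNoLeakGrid`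
(item stmt-AnomalousDissipation-14350).  The crux asks, for EVERY grid design `(Φ, G, c)`, for a vanishing-viscosity
family of global Leray–Hopf solutions of `NS_{ν_j}(Φ • G)` on `T³` with drift datum `∫ u₀ j = c e₀` and THREE properties:
(a) a per-`j` sup-in-time kinetic-energy bound, (b) `j`-uniformly bounded limsup-mean energy, (c) no Leray–Hopf leakage
in the mean, `⟨(f, u_j)⟩ ≤ ν_j⟨‖∇u_j‖²⟩`.  Write **UEDF** ("uniform-energy drift families") for the statement with (b)
alone.  This file records, sorry-free and with no definitions:

* `uniformEnergyDriftFamilies_of_boundedEnergyNoLeakGrid` : crux → UEDF (drop (a) and (c)) — UEDF is NECESSARY;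
* `boundedEnergyNoLeakGrid_of_noMeanLeakage` : `Correlation.NoMeanLeakage` → `Correlation.AbsorbingBallLHTorus` → UEDF → crux
  — UEDF is SUFFICIENT modulo two items of route Correlation that are universal statements about single Leray–Hopf
  solutions at fixed `ν > 0`: the support item `AbsorbingBallLHTorus` (stmt-AnomalousDissipation-0447, the absorbing
  ball, Foias–Manley–Rosa–Temam 2001 (A.41)–(A.42): provable, supplies (a)) and the crux `NoMeanLeakage`
  (stmt-AnomalousDissipation-14265, mean energy equality for Leray–Hopf solutions, open: FMRT 2001 p. 71; supplies (c));
* `boundedEnergyNoLeakGrid_iff_uniformEnergyDriftFamilies` : under those two items, crux ↔ UEDF.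

So the crux is EXACTLY turbulent saturation for grid designs (`Re ~ Gr^{1/2}`, Doering–Foias 2002 §3) once Leray–Hopf
mean energy equality is granted, and nothing weaker than UEDF can close it.  (The earlier regular door,
`boundedEnergyNoLeakGrid_of_regularDriftStates` in `ImpulseGridBoundedEnergyNoLeakGridOfRegularDriftStates`, pays for (c)
with regularity of the witnesses instead.)

References: C. Foias, O. Manley, R. Rosa, R. Temam, *Navier–Stokes Equations and Turbulence* (CUP 2001), p. 71,
(13.11), App. II.A (A.41)–(A.42); C. R. Doering, C. Foias, J. Fluid Mech. 467 (2002) §§2–3.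
-/

-- `Summit.<Summit>.<Problem>` is the tree's mandated summit-side namespace (CONVENTIONS §2); for this
-- single-conjunct summit the two coincide, so the duplicate is deliberate.
set_option linter.dupNamespace false

noncomputable section

open MeasureTheory Filter Set
open Literature.Analysis.FunctionSpaces Literature.Analysis.FunctionSpaces.Torus
open Literature.Analysis.FluidPDE Literature.Analysis.FluidPDE.Torus
open Summit.AnomalousDissipation.AnomalousDissipation.Theses

namespace Summit.AnomalousDissipation.AnomalousDissipation.Theorems

/-- **Necessity of UEDF**: `BoundedEnergyNoLeakGrid` implies, for every grid design, a vanishing-viscosity global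
Leray–Hopf family with drift datum `c e₀` and `j`-uniformly bounded mean energy (drop the per-`j` cap and the no-leak
clause). [folklore] -/
theorem uniformEnergyDriftFamilies_of_boundedEnergyNoLeakGrid :
    Summit.AnomalousDissipation.AnomalousDissipation.Theses.ImpulseGrid.BoundedEnergyNoLeakGrid → ∀ (Φ : UnitAddTorus (Fin 3) → ℝ) (G : UnitAddTorus (Fin 3) → EuclideanSpace ℝ (Fin 3)) (c : ℝ), IsSmooth Φ → IsSmooth G → (∀ (s : UnitAddCircle) x, Φ (x + Pi.single (1 : Fin 3) s) = Φ x ∧ Φ (x + Pi.single (2 : Fin 3) s) = Φ x) → (∫ x, Φ x = 1) → (∀ (s : UnitAddCircle) x, G (x + Pi.single (0 : Fin 3) s) = G x) → (∀ x, G x 0 = 0) → IsSmooth (fun x => Φ x • G x) → IsDivFree (fun x => Φ x • G x) → HasZeroMean (fun x => Φ x • G x) → 0 < c → ∃ (ν : ℕ → ℝ) (u₀ : ℕ → UnitAddTorus (Fin 3) → EuclideanSpace ℝ (Fin 3)) (u : ℕ → ℝ → UnitAddTorus (Fin 3) → EuclideanSpace ℝ (Fin 3)), (∀ j, 0 < ν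 j) ∧ Filter.Tendsto ν Filter.atTop (nhds 0) ∧ (∀ j, IsGlobalLerayHopf (ν j) (fun _ => fun x => Φ x • G x) (u₀ j) (u j)) ∧ (∀ j, ∫ x, u₀ j x = c • EuclideanSpace.single 0 1) ∧ (∃ E : ℝ, ∀ j, meanEnergy (u j) ≤ E) := by
  intro h Φ G c h1 h2 h3 h4 h5 h6 h7 h8 h9 h10
  obtain ⟨ν, u₀, u, hν, hν0, hLH, -, hdat, hE, -⟩ := h Φ G c h1 h2 h3 h4 h5 h6 h7 h8 h9 h10
  exact ⟨ν, u₀, u, hν, hν0, hLH, hdat, hE⟩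

/-- **Sufficiency of UEDF modulo Correlation's universal Leray–Hopf items**: granted the absorbing ball
(`Correlation.AbsorbingBallLHTorus`, stmt-AnomalousDissipation-0447) and mean energy equality for Leray–Hopf solutions
(`Correlation.NoMeanLeakage`, stmt-AnomalousDissipation-14265), uniform-energy drift families for every grid design give
`BoundedEnergyNoLeakGrid`: the per-`j` cap is the absorbing ball at `ν_j > 0` and the no-leak clause is `NoMeanLeakage` at
`(ν_j, Φ • G, u₀ j, u j)`. [folklore] -/
theorem boundedEnergyNoLeakGrid_of_noMeanLeakage :
    Summit.AnomalousDissipation.AnomalousDissipation.Theses.Correlation.NoMeanLeakage → Summit.AnomalousDissipation.AnomalousDissipation.Theses.Correlation.AbsorbingBallLHTorus → (∀ (Φ : UnitAddTorus (Fin 3) → ℝ) (G : UnitAddTorus (Fin 3) → EuclideanSpace ℝ (Fin 3)) (c : ℝ), IsSmooth Φ → IsSmooth G → (∀ (s : UnitAddCircle) x, Φ (x + Pi.single (1 : Fin 3) s) = Φ x ∧ Φ (x + Pi.single (2 : Fin 3) s) = Φ x) → (∫ x, Φ x = 1) → (∀ (s : UnitAddCircle) x, G (x + Pi.single (0 : Fin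 3) s) = G x) → (∀ x, G x 0 = 0) → IsSmooth (fun x => Φ x • G x) → IsDivFree (fun x => Φ x • G x) → HasZeroMean (fun x => Φ x • G x) → 0 < c → ∃ (ν : ℕ → ℝ) (u₀ : ℕ → UnitAddTorus (Fin 3) → EuclideanSpace ℝ (Fin 3)) (u : ℕ → ℝ → UnitAddTorus (Fin 3) → EuclideanSpace ℝ (Fin 3)), (∀ j, 0 < ν j) ∧ Filter.Tendsto ν Filter.atTop (nhds 0) ∧ (∀ j, IsGlobalLerayHopf (ν j) (fun _ => fun x => Φ x • G x) (u₀ j) (u j)) ∧ (∀ j, ∫ x, u₀ j x = c • EuclideanSpace.single 0 1) ∧ (∃ E : ℝ, ∀ j, meanEnergy (u j) ≤ E)) → Summit.AnomalousDissipation.AnomalousDissipation.Theses.ImpulseGrid.BoundedEnergyNoLeakGrid := by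
  intro hNL hAB hUE Φ G c h1 h2 h3 h4 h5 h6 h7 h8 h9 h10
  obtain ⟨ν, u₀, u, hν, hν0, hLH, hdat, hE⟩ := hUE Φ G c h1 h2 h3 h4 h5 h6 h7 h8 h9 h10
  exact ⟨ν, u₀, u, hν, hν0, hLH, fun j => hAB (ν j) _ (u₀ j) (u j) (hν j) h7 h9 (hLH j), hdat, hE,
    fun j => hNL (ν j) _ (u₀ j) (u j) (hν j) h7 h8 h9 (hLH j)⟩

/-- **The crux is its saturation half** modulo Correlation's universal Leray–Hopf items: under `NoMeanLeakage`
(stmt-AnomalousDissipation-14265) and `AbsorbingBallLHTorus` (stmt-AnomalousDissipation-0447),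
`BoundedEnergyNoLeakGrid ↔ UEDF`. [folklore] -/
theorem boundedEnergyNoLeakGrid_iff_uniformEnergyDriftFamilies :
    Summit.AnomalousDissipation.AnomalousDissipation.Theses.Correlation.NoMeanLeakage → Summit.AnomalousDissipation.AnomalousDissipation.Theses.Correlation.AbsorbingBallLHTorus → (Summit.AnomalousDissipation.AnomalousDissipation.Theses.ImpulseGrid.BoundedEnergyNoLeakGrid ↔ ∀ (Φ : UnitAddTorus (Fin 3) → ℝ) (G : UnitAddTorus (Fin 3) → EuclideanSpace ℝ (Fin 3)) (c : ℝ), IsSmooth Φ → IsSmooth G → (∀ (s : UnitAddCircle) x, Φ (x + Pi.single (1 : Fin 3) s) = Φ x ∧ Φ (x + Pi.single (2 : Fin 3) s) = Φ x) → (∫ x, Φ x = 1) → (∀ (s : UnitAddCircle) x, G (x + Pi.single (0 : Fin 3) s) = G x) → (∀ x, G x 0 = 0) → IsSmooth (fun x => Φ x • G x) → IsDivFree (fun x => Φ x • G x) → HasZeroMean (fun x => Φ x • G x) → 0 < c → ∃ (ν : ℕ → ℝ) (u₀ : ℕ → UnitAddTorus (Fin 3) → EuclideanSpace ℝ (Fin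 3)) (u : ℕ → ℝ → UnitAddTorus (Fin 3) → EuclideanSpace ℝ (Fin 3)), (∀ j, 0 < ν j) ∧ Filter.Tendsto ν Filter.atTop (nhds 0) ∧ (∀ j, IsGlobalLerayHopf (ν j) (fun _ => fun x => Φ x • G x) (u₀ j) (u j)) ∧ (∀ j, ∫ x, u₀ j x = c • EuclideanSpace.single 0 1) ∧ (∃ E : ℝ, ∀ j, meanEnergy (u j) ≤ E)) :=
  fun hNL hAB => ⟨uniformEnergyDriftFamilies_of_boundedEnergyNoLeakGrid, boundedEnergyNoLeakGrid_of_noMeanLeakage hNL hAB⟩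

/-- **The cap hypothesis of `stub_noMeanLeakageCapped` is idle**: the no-leak stub of skeleton v5 (no Leray–Hopf leakage in
the mean for forward-capped global Leray–Hopf solutions) is EQUIVALENT to Correlation's crux `NoMeanLeakage`
(stmt-AnomalousDissipation-14265), because every global Leray–Hopf solution at `ν > 0` under a smooth mean-zero steady force is
forward-capped (`BoundedEnergyNoLeakGrid.stub_absorbingBallGrid`, the absorbing ball). [folklore] -/
theorem noMeanLeakageCapped_iff_noMeanLeakage :
    (∀ (ν : ℝ) (f : UnitAddTorus (Fin 3) → EuclideanSpace ℝ (Fin 3)) (u₀ : UnitAddTorus (Fin 3) → EuclideanSpace ℝ (Fin 3)) (u : ℝ → UnitAddTorus (Fin 3) → EuclideanSpace ℝ (Fin 3)), 0 < ν → IsSmooth f → IsDivFree f → HasZeroMean f → IsGlobalLerayHopf ν (fun _ => f) u₀ u → (∃ C : ℝ, ∀ t : ℝ, 0 ≤ t → kineticEnergy (u t) ≤ C) → longTimeAvgSup (fun t => ∫ x, inner ℝ (f x) (u t x)) ≤ meanDissipation ν u) ↔ Summit.AnomalousDissipation.AnomalousDissipation.Theses.Correlation.NoMeanLeakage :=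
  ⟨fun h ν f u₀ u hν hf hdiv hzm hLH => h ν f u₀ u hν hf hdiv hzm hLH
      ((BoundedEnergyNoLeakGrid.stub_absorbingBallGrid ν f u₀ u hν hf hzm hLH).imp fun _ hC => hC.2),
    fun h ν f u₀ u hν hf hdiv hzm hLH _ => h ν f u₀ u hν hf hdiv hzm hLH⟩

/-! ### Cap-free forms (continuation lead c3, 2026-08-16): the absorbing ball is PROVED
(`BoundedEnergyNoLeakGrid.stub_absorbingBallGrid`, file `…StubAbsorbingBallGrid`), so Correlation's support item
`AbsorbingBallLHTorus` is no longer a hypothesis of the glue. -/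

/-- **Correlation's absorbing-ball support statement holds** (the statement of `Correlation.AbsorbingBallLHTorus`,
stmt-AnomalousDissipation-0447, Foias–Manley–Rosa–Temam 2001 (A.41)–(A.42)): immediate from the landed stub
`BoundedEnergyNoLeakGrid.stub_absorbingBallGrid` (drop its `0 ≤ C` conjunct).  Recorded here so that the glue below is
hypothesis-free on the cap; the item stmt-0447 itself is closed by whichever prover is served it. [cite: FoiasManleyRosaTemam2001, App. II.A (A.41)–(A.42)] -/
theorem absorbingBallLHTorus_of_stub :
    Summit.AnomalousDissipation.AnomalousDissipation.Theses.Correlation.AbsorbingBallLHTorus :=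
  fun ν f u₀ u hν hf hzm hLH =>
    (BoundedEnergyNoLeakGrid.stub_absorbingBallGrid ν f u₀ u hν hf hzm hLH).imp fun _ hC => hC.2

/-- **GLUE for the planner's split of the crux** (D-0019 glued split `NoMeanLeakage → UEDF → BoundedEnergyNoLeakGrid`):
mean energy equality for Leray–Hopf solutions (`Correlation.NoMeanLeakage`, stmt-AnomalousDissipation-14265) and
uniform-energy drift families for every grid design (UEDF — the registered stub `stub_uniformEnergyDriftFamilies` of
crux stmt-AnomalousDissipation-14350, written out) give `BoundedEnergyNoLeakGrid`, with NO further hypothesis: the per-`j`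
cap is the proved absorbing ball at `ν_j > 0`.  Together with `uniformEnergyDriftFamilies_of_boundedEnergyNoLeakGrid`
(UEDF is necessary) this pins the crux between UEDF and UEDF ∧ NoMeanLeakage. [folklore] -/
theorem boundedEnergyNoLeakGrid_of_noMeanLeakage_of_uedf :
    Summit.AnomalousDissipation.AnomalousDissipation.Theses.Correlation.NoMeanLeakage → (∀ (Φ : UnitAddTorus (Fin 3) → ℝ) (G : UnitAddTorus (Fin 3) → EuclideanSpace ℝ (Fin 3)) (c : ℝ), IsSmooth Φ → IsSmooth G → (∀ (s : UnitAddCircle) x, Φ (x + Pi.single (1 : Fin 3) s) = Φ x ∧ Φ (x + Pi.single (2 : Fin 3) s) = Φ x) → (∫ x, Φ x = 1) → (∀ (s : UnitAddCircle) x, G (x + Pi.single (0 : Fin 3) s) = G x) → (∀ x, G x 0 = 0) → IsSmooth (fun x => Φ x • G x) → IsDivFree (fun x => Φ x • G x) → HasZeroMean (fun x => Φ x • G x) → 0 < c → ∃ (ν : ℕ → ℝ) (u₀ : ℕ → UnitAddTorus (Fin 3) → EuclideanSpace ℝ (Fin 3)) (u : ℕ → ℝ → UnitAddTorus (Fin 3)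 → EuclideanSpace ℝ (Fin 3)), (∀ j, 0 < ν j) ∧ Filter.Tendsto ν Filter.atTop (nhds 0) ∧ (∀ j, IsGlobalLerayHopf (ν j) (fun _ => fun x => Φ x • G x) (u₀ j) (u j)) ∧ (∀ j, ∫ x, u₀ j x = c • EuclideanSpace.single 0 1) ∧ (∃ E : ℝ, ∀ j, meanEnergy (u j) ≤ E)) → Summit.AnomalousDissipation.AnomalousDissipation.Theses.ImpulseGrid.BoundedEnergyNoLeakGrid :=
  fun hNL => boundedEnergyNoLeakGrid_of_noMeanLeakage hNL absorbingBallLHTorus_of_stub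

/-- **The crux is its saturation half modulo ONE item**: under `Correlation.NoMeanLeakage` (stmt-AnomalousDissipation-14265)
alone, `BoundedEnergyNoLeakGrid ↔ UEDF` (cap-free form of `boundedEnergyNoLeakGrid_iff_uniformEnergyDriftFamilies`). [folklore] -/
theorem boundedEnergyNoLeakGrid_iff_uedf_of_noMeanLeakage :
    Summit.AnomalousDissipation.AnomalousDissipation.Theses.Correlation.NoMeanLeakage → (Summit.AnomalousDissipation.AnomalousDissipation.Theses.ImpulseGrid.BoundedEnergyNoLeakGrid ↔ ∀ (Φ : UnitAddTorus (Fin 3) → ℝ) (G : UnitAddTorus (Fin 3) → EuclideanSpace ℝ (Fin 3)) (c : ℝ), IsSmooth Φ → IsSmooth G → (∀ (s : UnitAddCircle) x, Φ (x + Pi.single (1 : Fin 3) s) = Φ x ∧ Φ (x + Pi.single (2 : Fin 3) s) = Φ x) → (∫ x, Φ x = 1) → (∀ (s : UnitAddCircle) x, G (x + Pi.single (0 : Fin 3) s) = G x) → (∀ x, G x 0 = 0) → IsSmooth (fun x => Φ x • G x) → IsDivFree (fun x => Φ x • G x) → HasZeroMean (fun x => Φ x • G x) → 0 < c → ∃ (ν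 : ℕ → ℝ) (u₀ : ℕ → UnitAddTorus (Fin 3) → EuclideanSpace ℝ (Fin 3)) (u : ℕ → ℝ → UnitAddTorus (Fin 3) → EuclideanSpace ℝ (Fin 3)), (∀ j, 0 < ν j) ∧ Filter.Tendsto ν Filter.atTop (nhds 0) ∧ (∀ j, IsGlobalLerayHopf (ν j) (fun _ => fun x => Φ x • G x) (u₀ j) (u j)) ∧ (∀ j, ∫ x, u₀ j x = c • EuclideanSpace.single 0 1) ∧ (∃ E : ℝ, ∀ j, meanEnergy (u j) ≤ E)) :=
  fun hNL => boundedEnergyNoLeakGrid_iff_uniformEnergyDriftFamilies hNL absorbingBallLHTorus_of_stub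

end Summit.AnomalousDissipation.AnomalousDissipation.Theorems
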